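import Mathlib

/-!
# The `2 × 2` identity behind the additive Tamagawa / level-lowering dictionary at `p = 3`
# (cell `b2b-bsdres`, team o6, planner o6-r1 GEN 8 — O6-GEN8 §1.1 / §3 typing offer (i);
#  FREEZE CANDIDATE for cc-typer-5, kernel arithmetic only, NOTHING asserted, nothing booked)

HONEST FRAMING (cell `b2b-bsdres`, verbatim): census output is EVIDENCE / conjecture items with held-out
validation, never a Literature fact; no main conjecture inside any certificate; nothing is booked.

WHAT. For `τ ∈ SL₂(ℤ)` (the action of a generator of tame inertia on the Tate module of an elliptic curve
with potentially good ADDITIVE reduction at `q`, when `ρ(I_q)` is cyclic), `det(τ − 1) = 2 − tr τ`.  For `τ` of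
order `2, 3, 4, 6` the trace is `−2, −1, 0, 1`, so `#coker(τ − 1 | ℤ²) = |det(τ − 1)| = 4, 3, 2, 1` — the order of
the geometric component group `Φ_q(k̄)` for Kodaira types `I₀*`, `IV/IV*`, `III/III*`, `II/II*`, and
`E[ℓ^∞]^{I_q} ≅ coker(τ − 1)[ℓ^∞]`.  At `ℓ = 3` this is the local lemma of O6-GEN8 §1.1: the inert additive
Tamagawa exponent / level-lowering defect `d_q = ord₃ det(τ − 1) = 𝟙[tr τ = −1] = 𝟙[IV/IV*] ∈ {0, 1}`.

TYPER PLACEMENT NOTE (cc-typer-5 GEN 5, literature-prover-b2b-bsdres-cc-typer-5-g5-0, 2026-08-21): o6-r1 GEN 8's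
FREEZE CANDIDATE `HOME/b2b-bsdres-o6-r1/gen8/lean/InertiaTraceComponentOrder.lean` (sha16 8eb873d8835ea2a6) placed
VERBATIM (statements and proofs byte-identical) as the O6 team's kernel arithmetic file; typer additions are
LINT-ONLY: `[folklore]` tags and the three missing docstrings (gate `lint.docstring` / `lint.tags`), plus ONE extra
lemma `det_sub_one_eq_two_sub_trace'` stating the identity over an arbitrary commutative ring (the planner's
parenthetical "indeed over any commutative ring"), from which nothing else depends.  THEOREMS ONLY: 0 defs, 0 facts,
nothing asserted about any curve, nothing booked, no mark of `RESIDUAL-MAP.md` moves.  The dictionary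
`coker(τ − 1) ≅ Φ_q(k̄)` / `E[3^∞]^{I_q}` it serves is O6-GEN8 §1.1 (memo `HOME/b2b-bsdres-o6-r1/gen8/O6-GEN8.md`);
the level-`E[3]` form already in the tree is `Additive.relIndex_kummerLocalConditionAt_sup_unramifiedSubgroup_of_hasAdditiveReductionAt`.
-/

namespace Summit.BirchSwinnertonDyer.Rank1Residual.AdditiveThree.InertiaTraceComponentOrder

/-- `det(A − 1) = 2 − tr A` for `A ∈ SL₂(ℤ)` (indeed over any commutative ring). [folklore] -/
theorem det_sub_one_eq_two_sub_trace (A : Matrix (Fin 2) (Fin 2) ℤ) (h : A.det = 1) :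
    (A - 1).det = 2 - A.trace := by
  rw [Matrix.det_fin_two] at h ⊢
  rw [Matrix.trace_fin_two]
  simp only [Matrix.sub_apply, Matrix.one_apply_eq, Matrix.one_apply_ne (by decide : (0 : Fin 2) ≠ 1),
    Matrix.one_apply_ne (by decide : (1 : Fin 2) ≠ 0)]
  linear_combination h

/-- Typer addition (the planner's parenthetical): `det(A − 1) = 2 − tr A` for every `2 × 2` matrix of
determinant `1` over ANY commutative ring. [folklore] -/
theorem det_sub_one_eq_two_sub_trace' {R : Type*} [CommRing R] (A : Matrix (Fin 2) (Fin 2) R)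
    (h : A.det = 1) : (A - 1).det = 2 - A.trace := by
  rw [Matrix.det_fin_two] at h ⊢
  rw [Matrix.trace_fin_two]
  simp only [Matrix.sub_apply, Matrix.one_apply_eq, Matrix.one_apply_ne (by decide : (0 : Fin 2) ≠ 1),
    Matrix.one_apply_ne (by decide : (1 : Fin 2) ≠ 0)]
  linear_combination h

/-- The component-order table: trace `−2, −1, 0, 1` (inertia of order `2, 3, 4, 6`) gives
`det(τ − 1) = 4, 3, 2, 1` (`I₀*`, `IV/IV*`, `III/III*`, `II/II*`). [folklore] -/
theorem det_sub_one_of_trace (A : Matrix (Fin 2) (Fin 2) ℤ) (h : A.det = 1) (t : ℤ)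
    (ht : A.trace = t) : (A - 1).det = 2 - t := by
  rw [det_sub_one_eq_two_sub_trace A h, ht]

/-- The `I₀*` line: `tr τ = −2` (inertia of order `2`) gives `det(τ − 1) = 4 = #Φ_q(k̄)`. [folklore] -/
theorem det_sub_one_of_trace_eq_neg_two (A : Matrix (Fin 2) (Fin 2) ℤ) (h : A.det = 1)
    (ht : A.trace = -2) : (A - 1).det = 4 := by
  rw [det_sub_one_of_trace A h (-2) ht]; norm_num

/-- The IV/IV* line: an order-3 inertia generator (`tr = −1`) has `det(τ − 1) = 3`, so
`E[3^∞]^{I_q} ≅ ℤ/3` exactly — congruence depth 1 in O6-GEN8 §1.1(d). [folklore] -/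
theorem det_sub_one_of_trace_eq_neg_one (A : Matrix (Fin 2) (Fin 2) ℤ) (h : A.det = 1)
    (ht : A.trace = -1) : (A - 1).det = 3 := by
  rw [det_sub_one_of_trace A h (-1) ht]; norm_num

/-- The `III/III*` line: `tr τ = 0` (inertia of order `4`) gives `det(τ − 1) = 2`. [folklore] -/
theorem det_sub_one_of_trace_eq_zero (A : Matrix (Fin 2) (Fin 2) ℤ) (h : A.det = 1)
    (ht : A.trace = 0) : (A - 1).det = 2 := by
  rw [det_sub_one_of_trace A h 0 ht]; norm_num

/-- The `II/II*` line: `tr τ = 1` (inertia of order `6`) gives `det(τ − 1) = 1`. [folklore] -/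
theorem det_sub_one_of_trace_eq_one (A : Matrix (Fin 2) (Fin 2) ℤ) (h : A.det = 1)
    (ht : A.trace = 1) : (A - 1).det = 1 := by
  rw [det_sub_one_of_trace A h 1 ht]; norm_num

/-- Sanity instance: the standard order-3 element `!![0, -1; 1, -1]` of `SL₂(ℤ)`. [folklore] -/
example : (!![0, -1; 1, -1] : Matrix (Fin 2) (Fin 2) ℤ).det = 1 ∧
    ((!![0, -1; 1, -1] : Matrix (Fin 2) (Fin 2) ℤ) - 1).det = 3 ∧
    (!![0, -1; 1, -1] : Matrix (Fin 2) (Fin 2) ℤ) ^ 3 = 1 := by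
  refine ⟨by simp [Matrix.det_fin_two], ?_, ?_⟩
  · simp [Matrix.det_fin_two, Matrix.sub_apply]
  · ext i j; fin_cases i <;> fin_cases j <;> simp [pow_succ, Matrix.mul_apply, Fin.sum_univ_two]

end Summit.BirchSwinnertonDyer.Rank1Residual.AdditiveThree.InertiaTraceComponentOrder
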